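import Summits.Ventures.WeilGRH.TwistedGramCoeffCReal
import Summits.Ventures.WeilGRH.TwistedFarComplex
import Summits.RiemannHypothesis.RiemannHypothesis.Theorems.WeilFormatCCertificate
import HarnessLib

/-!
# GRH arm (rh-explicit, venture WeilGRH): format C for a COMPLEX character on ONE real enumeration of the modes —
  block `2B − 1`, far coercivity discharged

Cell `rh-explicit`, WEIL TRACK — GRH ARM (lit/typing seat weil-grh-5 gen11).  By `TwistedGramCoeffCReal.lean` the χ-twisted
Gram kernel `G = twistedGramCoeffC χ a` is REAL symmetric for every character and its hermitian certificate is ONE real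
quadratic form (`weilPositivityOnChar_of_twistedGramCoeffC_re_psd`).  So weil-10's ℕ-indexed ∀N Schur soundness
(`WeilFormatC.sum_range_mul_mul_nonneg_of_certificate_sum`) applies to `Re G` on a SINGLE enumeration of `modes N`
(no `re/im` doubling as in `TwistedComplexCertificate.lean`): mode `ι(j) = 0, 1, −1, 2, −2, …`, i.e. `κ(p) = 2|p| − 1`
(`p > 0`), `2|p|` (`p ≤ 0`); `range (2N+1) ↔ modes N` (`sum_range_enum`), far `j ≥ 2B − 1 ↔ |p| ≥ B`, `|p| = (κ(p)+1)/2`.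

* `weilPositivityOnChar_of_twistedC_formatC_certificates_re` — `q ≠ 1`, ANY χ mod q, `a > 0`; `M : ℕ → ℕ → ℝ` a
  symmetric table with `M(κp, κp') = Re G(p,p')` (`hM`); block `2B − 1` (all `|p| < B`), `2 ≤ B`; far weights
  `W(n) = 2e⁻_B(n) − A_op⁺(a) + log q > 0` for `n ≥ B` (`hW`); a coupling majorant `U` (`hU`) and the kernel check `hS`
  ⟹ `WeilPositivityOnChar χ a`.  `hfar` is PROVED inside from `re_twistedGramCoeffC_modes_far_ge` (`TwistedFarComplex.lean`).

With the Cauchy structure `Re G(p,p') = (−1)^{p+p'}(F^χ_{p'} − F^χ_p)/(π(p' − p))` (`re_twistedGramCoeffC_offDiag`) the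
columns `j ↦ M(i,j)` have the one-term structure of weil-10's L-C3b on this enumeration (both signs of `p'`), so `hU` is
met by the same Hankel tails; that bookkeeping is left to the producer / a successor.  No definitions; no named facts;
RH/GRH-free; standard axioms.
-/

set_option autoImplicit false

noncomputable section

open Complex Finset Matrix
open scoped Real BigOperators ComplexConjugate ArithmeticFunction.vonMangoldt

namespace Summit.Ventures.WeilGRH

open Literature.NumberTheory.LFunctions
open Literature.NumberTheory.LFunctions.Yoshida1992 (modes freq mem_modes)
open Literature.Analysis.SpecialFunctions
open Summit.RiemannHypothesis.RiemannHypothesis.Theorems.WeilFormatC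

variable {q : ℕ} {a : ℝ}

/-! ## The enumeration `κ` of `modes N` -/

section Enum

/-- `κ p < 2B − 1` when `|p| < B`. -/
theorem kappa_lt_of_natAbs_lt {p : ℤ} {B : ℕ} (hp : p.natAbs < B) :
    (if 0 < p then 2 * p.natAbs - 1 else 2 * p.natAbs) < 2 * B - 1 := by
  split_ifs <;> omega

/-- `2N + 1 ≤ κ p` when `N < |p|`. -/
theorem le_kappa_of_lt_natAbs {p : ℤ} {N : ℕ} (hp : N < p.natAbs) :
    2 * N + 1 ≤ (if 0 < p then 2 * p.natAbs - 1 else 2 * p.natAbs) := by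
  split_ifs <;> omega

/-- `(κ p + 1)/2 = |p|`. -/
theorem modeAbs_kappa (p : ℤ) : ((if 0 < p then 2 * p.natAbs - 1 else 2 * p.natAbs) + 1) / 2 = p.natAbs := by
  split_ifs with h
  · have : 1 ≤ p.natAbs := by omega
    omega
  · omega

/-- **`range (2N+1) ↔ modes N`**: `Σ_{j<2N+1} F(j) = Σ_{p∈modes N} F(κ p)`. -/
theorem sum_range_enum (F : ℕ → ℝ) (N : ℕ) :
    ∑ j ∈ Finset.range (2 * N + 1), F j = ∑ p ∈ modes N, F (if 0 < p then 2 * p.natAbs - 1 else 2 * p.natAbs) := by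
  induction N with
  | zero =>
    have h0 : modes 0 = {0} := by ext k; simp [mem_modes]
    rw [h0, Finset.sum_singleton]
    simp
  | succ N ih =>
    rw [show 2 * (N + 1) + 1 = 2 * N + 1 + 1 + 1 by ring, Finset.sum_range_succ, Finset.sum_range_succ, ih, modes_succ,
      Finset.sum_insert, Finset.sum_insert]
    · have e1 : (if (0 : ℤ) < (N : ℤ) + 1 then 2 * ((N : ℤ) + 1).natAbs - 1 else 2 * ((N : ℤ) + 1).natAbs) = 2 * N + 1 := by
        rw [if_pos (by positivity)]; omega
      have e2 : (if (0 : ℤ) < -((N : ℤ) + 1) then 2 * (-((N : ℤ) + 1)).natAbs - 1 else 2 * (-((N : ℤ) + 1)).natAbs)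
          = 2 * N + 1 + 1 := by
        rw [if_neg (by omega)]; omega
      rw [e1, e2]
      ring
    · simp only [mem_modes, abs_le]; omega
    · simp only [Finset.mem_insert, mem_modes, abs_le]
      omega

/-- Double-sum form of `sum_range_enum`. -/
theorem sum_sum_range_enum (Φ : ℕ → ℕ → ℝ) (N : ℕ) :
    ∑ j ∈ Finset.range (2 * N + 1), ∑ j' ∈ Finset.range (2 * N + 1), Φ j j'
      = ∑ p ∈ modes N, ∑ p' ∈ modes N,
          Φ (if 0 < p then 2 * p.natAbs - 1 else 2 * p.natAbs) (if 0 < p' then 2 * p'.natAbs - 1 else 2 * p'.natAbs) := by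
  rw [sum_range_enum]
  exact Finset.sum_congr rfl fun p _ ↦ sum_range_enum _ N

end Enum

/-! ## The certificate theorem -/

section Cert

/-- **Format C for a COMPLEX character on one real enumeration.**  See the module docstring. -/
theorem weilPositivityOnChar_of_twistedC_formatC_certificates_re (hq : q ≠ 1) (χ : DirichletCharacter ℂ q)
    (ha : 0 < a) (M : ℕ → ℕ → ℝ) (hsymm : ∀ j j', M j j' = M j' j)
    (hM : ∀ p p' : ℤ,
      M (if 0 < p then 2 * p.natAbs - 1 else 2 * p.natAbs) (if 0 < p' then 2 * p'.natAbs - 1 else 2 * p'.natAbs)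
        = (twistedGramCoeffC χ a p p').re)
    {B : ℕ} (hB : 2 ≤ B)
    (hW : ∀ n : ℕ, B ≤ n → 0 <
      2 * ((reDigammaQuarter (freq a n) - Real.log π) / 2 - 1 / (8 * (n : ℝ))
          - a * (1 + weilArchDensity (2 * a)) / (π ^ 2 * (n : ℝ) ^ 2)
          - (π / 2 - Real.arctan (Real.sqrt ((B - 1 : ℕ) : ℝ) / Real.sqrt (n : ℝ))) / 2
          - a * (1 + weilArchDensity (2 * a)) / π ^ 2 * Real.sqrt (8 / ((B - 1 : ℕ) : ℝ)))
        - (∑ k ∈ weilPrimeIndex a, (Λ k : ℝ) / Real.sqrt k * (2 * Real.cos (π / (⌊2 * a / Real.log k⌋₊ + 2))))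
        + Real.log q)
    (U : Matrix (Fin (2 * B - 1)) (Fin (2 * B - 1)) ℝ)
    (hU : ∀ (N' : ℕ) (x : Fin (2 * B - 1) → ℝ),
      ∑ j ∈ Finset.Ico (2 * B - 1) N', (∑ i : Fin (2 * B - 1), M i j * x i) ^ 2 /
        (2 * ((reDigammaQuarter (freq a ((j + 1) / 2 : ℕ)) - Real.log π) / 2 - 1 / (8 * (((j + 1) / 2 : ℕ) : ℝ))
          - a * (1 + weilArchDensity (2 * a)) / (π ^ 2 * (((j + 1) / 2 : ℕ) : ℝ) ^ 2)
          - (π / 2 - Real.arctan (Real.sqrt ((B - 1 : ℕ) : ℝ) / Real.sqrt (((j + 1) / 2 : ℕ) : ℝ))) / 2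
          - a * (1 + weilArchDensity (2 * a)) / π ^ 2 * Real.sqrt (8 / ((B - 1 : ℕ) : ℝ)))
        - (∑ k ∈ weilPrimeIndex a, (Λ k : ℝ) / Real.sqrt k * (2 * Real.cos (π / (⌊2 * a / Real.log k⌋₊ + 2))))
        + Real.log q)
        ≤ x ⬝ᵥ U *ᵥ x)
    (hS : ∀ x : Fin (2 * B - 1) → ℝ, 0 ≤ ∑ i, ∑ j, x i * x j * (M i j - U i j)) :
    WeilPositivityOnChar χ a := by
  -- the far weight as a function of the mode size
  set W : ℕ → ℝ := fun n ↦ 2 * ((reDigammaQuarter (freq a n) - Real.log π) / 2 - 1 / (8 * (n : ℝ))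
          - a * (1 + weilArchDensity (2 * a)) / (π ^ 2 * (n : ℝ) ^ 2)
          - (π / 2 - Real.arctan (Real.sqrt ((B - 1 : ℕ) : ℝ) / Real.sqrt (n : ℝ))) / 2
          - a * (1 + weilArchDensity (2 * a)) / π ^ 2 * Real.sqrt (8 / ((B - 1 : ℕ) : ℝ)))
        - (∑ k ∈ weilPrimeIndex a, (Λ k : ℝ) / Real.sqrt k * (2 * Real.cos (π / (⌊2 * a / Real.log k⌋₊ + 2))))
        + Real.log q with hWdef
  have hmode : ∀ j : ℕ, 2 * B - 1 ≤ j → B ≤ (j + 1) / 2 := fun j hj ↦ by omega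
  have hd : ∀ j, 2 * B - 1 ≤ j → 0 < W ((j + 1) / 2) := fun j hj ↦ hW _ (hmode j hj)
  -- hfar from the mode-level bound, on real vectors
  have hfar : ∀ (N' : ℕ) (y : ℕ → ℝ),
      ∑ j ∈ Finset.Ico (2 * B - 1) N', W ((j + 1) / 2) * y j ^ 2
        ≤ ∑ j ∈ Finset.Ico (2 * B - 1) N', ∑ j' ∈ Finset.Ico (2 * B - 1) N', y j * M j j' * y j' := by
    intro N' y
    set v : ℕ → ℝ := fun j ↦ if 2 * B - 1 ≤ j ∧ j < N' then y j else 0 with hv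
    have hvz : ∀ j, ¬ (2 * B - 1 ≤ j ∧ j < N') → v j = 0 := fun j hj ↦ by simp only [hv, if_neg hj]
    have hsub : Finset.Ico (2 * B - 1) N' ⊆ Finset.range (2 * N' + 1) := fun j hj ↦ by
      rw [Finset.mem_Ico] at hj; rw [Finset.mem_range]; omega
    have hl : ∑ j ∈ Finset.Ico (2 * B - 1) N', W ((j + 1) / 2) * y j ^ 2
        = ∑ j ∈ Finset.range (2 * N' + 1), W ((j + 1) / 2) * v j ^ 2 := by
      rw [← Finset.sum_subset hsub (fun j _ hj ↦ by
        rw [hvz j (by rwa [Finset.mem_Ico] at hj)]; ring)]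
      refine Finset.sum_congr rfl fun j hj ↦ ?_
      rw [Finset.mem_Ico] at hj
      simp only [hv, if_pos hj]
    have hr : ∑ j ∈ Finset.Ico (2 * B - 1) N', ∑ j' ∈ Finset.Ico (2 * B - 1) N', y j * M j j' * y j'
        = ∑ j ∈ Finset.range (2 * N' + 1), ∑ j' ∈ Finset.range (2 * N' + 1), v j * v j' * M j j' := by
      rw [← Finset.sum_subset hsub (fun j _ hj ↦ by
        refine Finset.sum_eq_zero fun j' _ ↦ ?_
        rw [hvz j (by rwa [Finset.mem_Ico] at hj)]; ring)]
      refine Finset.sum_congr rfl fun j hj ↦ ?_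
      rw [← Finset.sum_subset hsub (fun j' _ hj' ↦ by
        rw [hvz j' (by rwa [Finset.mem_Ico] at hj')]; ring)]
      refine Finset.sum_congr rfl fun j' hj' ↦ ?_
      rw [Finset.mem_Ico] at hj hj'
      simp only [hv, if_pos hj, if_pos hj']
      ring
    rw [hl, hr, sum_range_enum (fun j ↦ W ((j + 1) / 2) * v j ^ 2) N',
      sum_sum_range_enum (fun j j' ↦ v j * v j' * M j j') N']
    simp_rw [modeAbs_kappa, hM]
    -- the real vector as a complex one
    have key := re_twistedGramCoeffC_modes_far_ge χ ha hB N'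
      (fun p ↦ ((v (if 0 < p then 2 * p.natAbs - 1 else 2 * p.natAbs) : ℝ) : ℂ)) (fun p hp ↦ ?_) (fun p hp ↦ ?_)
    · rw [re_sum_sum_conj_mul_twistedGramCoeffC] at key
      simp only [Complex.ofReal_re, Complex.ofReal_im, mul_zero, add_zero, Complex.norm_real, Real.norm_eq_abs,
        sq_abs] at key
      simpa only [hWdef] using key
    · have h0 := hvz _ (fun h ↦ absurd h.1 (not_le.mpr (kappa_lt_of_natAbs_lt hp)))
      rw [h0]; simp
    · have h0 := hvz _ (fun h ↦ absurd h.2 (not_lt.mpr ((by omega : N' ≤ 2 * N' + 1).trans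
        (le_kappa_of_lt_natAbs hp))))
      rw [h0]; simp
  refine weilPositivityOnChar_of_twistedGramCoeffC_re_psd hq χ ha fun N x ↦ ?_
  -- the enumerated vector of x
  set v : ℕ → ℝ := fun j ↦ x (if j % 2 = 1 then (((j + 1) / 2 : ℕ) : ℤ) else -((j / 2 : ℕ) : ℤ)) with hv
  have key := sum_range_mul_mul_nonneg_of_certificate_sum M hsymm (2 * B - 1) (fun j ↦ W ((j + 1) / 2)) U hd hfar
    hU hS (2 * N + 1) v
  rw [sum_sum_range_enum (fun j j' ↦ v j * v j' * M j j') N] at key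
  have hx : ∀ p : ℤ, v (if 0 < p then 2 * p.natAbs - 1 else 2 * p.natAbs) = x p := fun p ↦ by
    simp only [hv]
    split_ifs <;> first | omega | (congr 1; omega)
  simp_rw [hx, hM] at key
  exact key

end Cert

end Summit.Ventures.WeilGRH

end
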